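import Summits.ValiantsHypothesis.ValiantsHypothesis.Theorems.SymPencilPerFourCrossSix
import Summits.ValiantsHypothesis.ValiantsHypothesis.Theorems.SymPencilPerFourJointFamilyTransport

/-!
# Route `SymPencil` — transport of the base-point package under the symmetries of `per_4`, and
# the cross-space exclusion for the whole `S₄ × S₄ × ⟨ᵀ⟩`-orbit of `V×`
# (`--supports` stmt-ValiantsHypothesis-5674 `SdcSuperquadratic`; cell `(10,6,6)` of the
# size-`27` kernel-package table; rung currency only, nothing here bears on `VP ≠ VNP`)

`SymPencilPerFourCrossSix.false_of_ker_eq_cross` excludes the kernel space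
`V× = row 0 ⊕ k E₁₀ ⊕ k E₂₀` in NORMALISED position.  A classification of the candidates of the
cell `(10,6,6)` produces `V×` only up to a symmetry of `per_4`; this file moves the PACKAGE
instead of the subspace: if `Φ` is a linear automorphism of `k^{4×4}` with
`per_4 (Φ z) = χ · per_4 (z)` (`χ ≠ 0`), then `(D, bL ∘ Φ, CL ∘ Φ, χ κ)` satisfies the same
base-point identities as `(D, bL, CL, κ)` (`package_transport`), with kernel `Φ⁻¹ (ker bL)`, the
same rank and the same determinant constancy.  Hence (`false_of_ker_eq_cross_map`) a package
whose kernel space is `Φ (V×)` is impossible at `|ι'| ≤ 26`, `dim (im bL) ≥ 10`; the instances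
for row/column permutations (`…_prodCongr`, `SymPencilPerFourBlocks.eval_perPoly_comp_prodCongr`)
and for transposition composed with permutations (`…_transpose_prodCongr`,
`SymPencilPerFourTwoRowsRadical.eval_perPoly_transpose`) cover every cross
`row r ∪ {E_{i c}, E_{i' c}}` and every transposed cross.  No definitions, no named facts.
[folklore]
-/

noncomputable section

-- single-conjunct layout: Sub = Summit, duplicated namespace component intended
set_option linter.dupNamespace false

namespace Summit.ValiantsHypothesis.ValiantsHypothesis.Theorems.SymPencilPerFourCrossSixTransport

open Matrix MvPolynomial Module
open Literature.Computability.AlgebraicComplexity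
open Summit.ValiantsHypothesis.ValiantsHypothesis.Theorems.SymPencilPerFourCrossSix
open Summit.ValiantsHypothesis.ValiantsHypothesis.Theorems.SymPencilPerFourBlocks
open Summit.ValiantsHypothesis.ValiantsHypothesis.Theorems.SymPencilPerFourTwoRowsRadical

universe u

variable {k : Type u} [Field k] [CharZero k] {ι' : Type*} [Fintype ι'] [DecidableEq ι']

omit [CharZero k] in
/-- **Transport of the base-point identities** along a `per_4`-semi-invariant linear automorphism
`Φ` (`per_4 (Φ z) = χ per_4 (z)`): the pair `(bL ∘ Φ, CL ∘ Φ)` satisfies them with `χ κ`.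
[folklore] -/
theorem package_transport {D : Matrix ι' ι' k}
    (bL : (Fin 4 × Fin 4 → k) →ₗ[k] (ι' → k)) (CL : (Fin 4 × Fin 4 → k) →ₗ[k] Matrix ι' ι' k)
    {κ : k}
    (hN : ∀ v, bL v = 0 → IsUnit (D + CL v).det ∧ ∀ (z : Fin 4 × Fin 4 → k) (s : k),
      κ * MvPolynomial.eval (v + s • z) (perPoly (Fin 4) k) =
        (Matrix.fromBlocks ((s * 0) • (1 : Matrix Unit Unit k))
          (Matrix.replicateRow Unit (s • bL z)) (Matrix.replicateCol Unit (s • bL z))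
          (D + CL v + s • CL z)).det)
    (Φ : (Fin 4 × Fin 4 → k) ≃ₗ[k] (Fin 4 × Fin 4 → k)) (χ : k)
    (hΦ : ∀ z, MvPolynomial.eval (Φ z) (perPoly (Fin 4) k) =
      χ * MvPolynomial.eval z (perPoly (Fin 4) k))
    (v : Fin 4 × Fin 4 → k) (hv : (bL ∘ₗ Φ.toLinearMap) v = 0) :
    IsUnit (D + (CL ∘ₗ Φ.toLinearMap) v).det ∧ ∀ (z : Fin 4 × Fin 4 → k) (s : k),
      (χ * κ) * MvPolynomial.eval (v + s • z) (perPoly (Fin 4) k) =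
        (Matrix.fromBlocks ((s * 0) • (1 : Matrix Unit Unit k))
          (Matrix.replicateRow Unit (s • (bL ∘ₗ Φ.toLinearMap) z))
          (Matrix.replicateCol Unit (s • (bL ∘ₗ Φ.toLinearMap) z))
          (D + (CL ∘ₗ Φ.toLinearMap) v + s • (CL ∘ₗ Φ.toLinearMap) z)).det := by
  obtain ⟨hu, hdet⟩ := hN (Φ v) hv
  refine ⟨hu, fun z s => ?_⟩
  have h := hdet (Φ z) s
  rw [← map_smul, ← map_add, hΦ] at h
  simp only [LinearMap.coe_comp, LinearEquiv.coe_coe, Function.comp_apply]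
  rw [← h]
  ring

/-- **The cross space in any position of its orbit is not a kernel space** (package form): if
`Φ` is a `per_4`-semi-invariant linear automorphism and the kernel space of the package is
`Φ (V×)`, i.e. `bL x = 0 ↔ Φ⁻¹ x ∈ V×`, then `False` (`|ι'| ≤ 26`, `dim (im bL) ≥ 10`,
determinant constancy along the kernel). [folklore] -/
theorem false_of_ker_eq_cross_map {D : Matrix ι' ι' k} (hD : IsUnit D.det) (hDs : Dᵀ = D)
    (bL : (Fin 4 × Fin 4 → k) →ₗ[k] (ι' → k)) (CL : (Fin 4 × Fin 4 → k) →ₗ[k] Matrix ι' ι' k)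
    (hCs : ∀ z, (CL z)ᵀ = CL z) {κ : k} (hκ : κ ≠ 0)
    (hii : ∀ z, bL z ⬝ᵥ (D⁻¹ * CL z * D⁻¹) *ᵥ bL z = 0)
    (hN : ∀ v, bL v = 0 → IsUnit (D + CL v).det ∧ ∀ (z : Fin 4 × Fin 4 → k) (s : k),
      κ * MvPolynomial.eval (v + s • z) (perPoly (Fin 4) k) =
        (Matrix.fromBlocks ((s * 0) • (1 : Matrix Unit Unit k))
          (Matrix.replicateRow Unit (s • bL z)) (Matrix.replicateCol Unit (s • bL z))
          (D + CL v + s • CL z)).det)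
    (Φ : (Fin 4 × Fin 4 → k) ≃ₗ[k] (Fin 4 × Fin 4 → k)) (χ : k) (hχ : χ ≠ 0)
    (hΦ : ∀ z, MvPolynomial.eval (Φ z) (perPoly (Fin 4) k) =
      χ * MvPolynomial.eval z (perPoly (Fin 4) k))
    (hker : ∀ x : Fin 4 × Fin 4 → k,
      bL x = 0 ↔ ∀ z : Fin 4 × Fin 4, ¬ (z.1 = 0 ∨ z = (1, 0) ∨ z = (2, 0)) → Φ.symm x z = 0)
    (h10 : 10 ≤ finrank k (LinearMap.range bL)) (hcard : Fintype.card ι' ≤ 26)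
    (hdet : ∀ v, bL v = 0 → ∀ t : k, (D + t • CL v).det = D.det) : False := by
  have hN' := package_transport bL CL hN Φ χ hΦ
  refine false_of_ker_eq_cross hD hDs (bL ∘ₗ Φ.toLinearMap) (CL ∘ₗ Φ.toLinearMap)
    (fun z => hCs _) (mul_ne_zero hχ hκ) (fun z => hii _) hN' (fun x => ?_) ?_ hcard ?_
  · rw [LinearMap.comp_apply, hker]
    simp
  · rw [LinearMap.range_comp_of_range_eq_top _ Φ.range]
    exact h10
  · intro v hv t
    have h := hdet (Φ v) hv t
    simpa using h

/-- **Row/column permutations**: the cross `Φ(V×)` with `Φ z = z ∘ (σ × τ)⁻¹`-type relabelling is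
excluded; concretely, if `bL x = 0 ↔ (x ∘ (σ × τ)) ∈ V×` (i.e. the kernel space is the cross
`row σ 0 ∪ {E_{σ 1, τ 0}, E_{σ 2, τ 0}}`) then `False`. [folklore] -/
theorem false_of_ker_eq_cross_prodCongr {D : Matrix ι' ι' k} (hD : IsUnit D.det) (hDs : Dᵀ = D)
    (bL : (Fin 4 × Fin 4 → k) →ₗ[k] (ι' → k)) (CL : (Fin 4 × Fin 4 → k) →ₗ[k] Matrix ι' ι' k)
    (hCs : ∀ z, (CL z)ᵀ = CL z) {κ : k} (hκ : κ ≠ 0)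
    (hii : ∀ z, bL z ⬝ᵥ (D⁻¹ * CL z * D⁻¹) *ᵥ bL z = 0)
    (hN : ∀ v, bL v = 0 → IsUnit (D + CL v).det ∧ ∀ (z : Fin 4 × Fin 4 → k) (s : k),
      κ * MvPolynomial.eval (v + s • z) (perPoly (Fin 4) k) =
        (Matrix.fromBlocks ((s * 0) • (1 : Matrix Unit Unit k))
          (Matrix.replicateRow Unit (s • bL z)) (Matrix.replicateCol Unit (s • bL z))
          (D + CL v + s • CL z)).det)
    (σ τ : Equiv.Perm (Fin 4))
    (hker : ∀ x : Fin 4 × Fin 4 → k,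
      bL x = 0 ↔ ∀ z : Fin 4 × Fin 4, ¬ (z.1 = 0 ∨ z = (1, 0) ∨ z = (2, 0)) →
        x ((Equiv.prodCongr σ τ) z) = 0)
    (h10 : 10 ≤ finrank k (LinearMap.range bL)) (hcard : Fintype.card ι' ≤ 26)
    (hdet : ∀ v, bL v = 0 → ∀ t : k, (D + t • CL v).det = D.det) : False := by
  have hΦs : ∀ z : Fin 4 × Fin 4 → k,
      (LinearEquiv.funCongrLeft k k (Equiv.prodCongr σ τ)).symm z =
        z ∘ (Equiv.prodCongr σ.symm τ.symm) := by
    intro z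
    ext p
    simp [LinearEquiv.funCongrLeft_symm, LinearEquiv.funCongrLeft_apply]
  refine false_of_ker_eq_cross_map hD hDs bL CL hCs hκ hii hN
    (LinearEquiv.funCongrLeft k k (Equiv.prodCongr σ τ)).symm 1 one_ne_zero (fun z => ?_)
    (fun x => ?_) h10 hcard hdet
  · rw [one_mul, hΦs]
    exact eval_perPoly_comp_prodCongr σ.symm τ.symm z
  · rw [hker x, LinearEquiv.symm_symm]
    simp only [LinearEquiv.funCongrLeft_apply, LinearMap.funLeft_apply]

/-- **Transposed crosses**: if the kernel space is the TRANSPOSE of a permuted cross, i.e.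
`bL x = 0 ↔ (z ↦ x (τ z.2, σ z.1)) ∈ V×` (kernel space = column `τ 0 ∪ {E_{σ 0, τ 1}, E_{σ 0, τ 2}}`-type
cross), then `False`. [folklore] -/
theorem false_of_ker_eq_cross_transpose_prodCongr {D : Matrix ι' ι' k} (hD : IsUnit D.det)
    (hDs : Dᵀ = D)
    (bL : (Fin 4 × Fin 4 → k) →ₗ[k] (ι' → k)) (CL : (Fin 4 × Fin 4 → k) →ₗ[k] Matrix ι' ι' k)
    (hCs : ∀ z, (CL z)ᵀ = CL z) {κ : k} (hκ : κ ≠ 0)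
    (hii : ∀ z, bL z ⬝ᵥ (D⁻¹ * CL z * D⁻¹) *ᵥ bL z = 0)
    (hN : ∀ v, bL v = 0 → IsUnit (D + CL v).det ∧ ∀ (z : Fin 4 × Fin 4 → k) (s : k),
      κ * MvPolynomial.eval (v + s • z) (perPoly (Fin 4) k) =
        (Matrix.fromBlocks ((s * 0) • (1 : Matrix Unit Unit k))
          (Matrix.replicateRow Unit (s • bL z)) (Matrix.replicateCol Unit (s • bL z))
          (D + CL v + s • CL z)).det)
    (σ τ : Equiv.Perm (Fin 4))
    (hker : ∀ x : Fin 4 × Fin 4 → k,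
      bL x = 0 ↔ ∀ z : Fin 4 × Fin 4, ¬ (z.1 = 0 ∨ z = (1, 0) ∨ z = (2, 0)) →
        x (τ z.2, σ z.1) = 0)
    (h10 : 10 ≤ finrank k (LinearMap.range bL)) (hcard : Fintype.card ι' ≤ 26)
    (hdet : ∀ v, bL v = 0 → ∀ t : k, (D + t • CL v).det = D.det) : False := by
  -- `Φ.symm x = z ↦ x (τ z.2, σ z.1)`, i.e. `Φ.symm = funCongrLeft (prodCongr σ τ ∘ prodComm)`
  set e : Fin 4 × Fin 4 ≃ Fin 4 × Fin 4 :=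
    (Equiv.prodComm (Fin 4) (Fin 4)).trans (Equiv.prodCongr τ σ) with he
  have he_apply : ∀ z : Fin 4 × Fin 4, e z = (τ z.2, σ z.1) := fun z => by
    obtain ⟨i, j⟩ := z
    rfl
  have hΦs : ∀ z : Fin 4 × Fin 4 → k,
      (LinearEquiv.funCongrLeft k k e).symm z = z ∘ e.symm := by
    intro z
    ext p
    simp [LinearEquiv.funCongrLeft_symm, LinearEquiv.funCongrLeft_apply]
  have hinv : ∀ z : Fin 4 × Fin 4 → k,
      MvPolynomial.eval (z ∘ e.symm) (perPoly (Fin 4) k) =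
        MvPolynomial.eval z (perPoly (Fin 4) k) := by
    intro z
    have h1 : z ∘ e.symm = LinearEquiv.funCongrLeft k k (Equiv.prodComm (Fin 4) (Fin 4))
        (z ∘ (Equiv.prodCongr σ.symm τ.symm)) := by
      ext p
      obtain ⟨i, j⟩ := p
      simp [he, LinearEquiv.funCongrLeft_apply, Equiv.prodCongr_apply]
    rw [h1, eval_perPoly_transpose, eval_perPoly_comp_prodCongr]
  refine false_of_ker_eq_cross_map hD hDs bL CL hCs hκ hii hN
    (LinearEquiv.funCongrLeft k k e).symm 1 one_ne_zero (fun z => ?_) (fun x => ?_) h10 hcard hdet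
  · rw [one_mul, hΦs]
    exact hinv z
  · rw [hker x, LinearEquiv.symm_symm]
    simp only [LinearEquiv.funCongrLeft_apply, LinearMap.funLeft_apply, he_apply]

end Summit.ValiantsHypothesis.ValiantsHypothesis.Theorems.SymPencilPerFourCrossSixTransport

end
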